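import Summits.HodgeConjecture.CorCM.MultiFieldWeilTwoSimpleThreefolds
import Summits.HodgeConjecture.CorCM.SimpleCMThreefoldPairsHodge
import Summits.HodgeConjecture.CorCM.CMAbelianVarietyDimLeThreePowers
import Summits.HodgeConjecture.CorCM.BiproductSlotsDomination
import Summits.HodgeConjecture.CorCM.Model.CMProdBiproduct
import Summits.HodgeConjecture.CorCM.Model.CMAbelianVarietyRealisedHolds
import Summits.HodgeConjecture.CorCM.DihedralSexticPairWeights
import HarnessLib

/-!
# MULTI-FIELD WEIL ENGINE — ANY TWO SIMPLE CM ABELIAN THREEFOLDS: the Hodge conjecture for EVERY product of copies `T₀^a × T₁^b`, given ONLY Markman's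
# fourfold theorem (no hypothesis on the two sextic CM fields, on the types, or on the relation between the threefolds)

Cell `pub-hodgecm2` (COR-CM), seat b30 gen 31 (2026-08-24); count-neutral own lane MULTI-FIELD WEIL ENGINE (stem `MultiFieldWeil*`), sequel of
`CorCM/MultiFieldWeilTwoSimpleThreefolds.lean`.  Theorems only; no definition, no named fact, no `sorry`.  HONEST FRAMING: conditional on the displayed Markman fourfold
binder only (and in two of the three cases not even on that); `HC_CM` is NOT proved and not asserted.

THE STATEMENT (**`hodgeConjectureFor_biproduct_comp_vec_of_any_two_simpleThreefolds_of_markman`**).  `T₀ ⊨ (K₀; Φ₀)` and `T₁ ⊨ (K₁; Φ₁)` SIMPLE complex abelian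
threefolds with complex multiplication by sextic CM fields `K₀`, `K₁` (realisations read on `H¹`, `IsCMTypeRealisation`).  Then for EVERY `κ : Fin N → Fin 2` every rational
`(p,p)`-class on `⨁_j ![T₀, T₁] (κ j)` — that is on every product `T₀^a × T₁^b` of copies in any number and order — is algebraic, GIVEN ONLY
`Markman2025_weilClasses_algebraic_abelianFourfold`; and the same for every abelian variety such a product dominates.  The trichotomy, all BY NAME:
* `T₀ ∼ T₁`: the product is isogenous to `⨁_{Fin N} T₀` (`AbelianVariety.IsIsogenous.biproduct`), an isogeny factor of a power of the CM threefold `T₀`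
  (`exists_avDominatedBy_biproduct_slots_powSucc`) — UNCONDITIONAL by b16's `hodgeConjectureFor_of_avDominatedBy_powSucc_of_isOfCMType_of_dim_le_three`
  (Moonen–Zarhin: CM abelian varieties of dimension `≤ 3` are stably nondegenerate);
* `T₀ ≁ T₁` and `K₀`, `K₁` share NO imaginary quadratic subfield: UNCONDITIONAL by b16's `hodgeConjectureFor_prod_simpleThreefolds` (`Hg(T₀ × T₁) = Hg(T₀) × Hg(T₁)`);
* `T₀ ≁ T₁` and a common imaginary quadratic subfield `k = F ≤ K₀`, `F ↪ K₁`: `k` is a CM field, its CM type `{σ}` is realised by a CM elliptic curve `E` (the tree's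
  `cmAbelianVarietyRealised_holds`), and gen 31's `hodgeConjectureFor_biproduct_comp_vec_of_two_simpleThreefolds_of_markman` gives the Hodge conjecture for every
  `E^c × T₀^a × T₁^b` modulo Markman's fourfold theorem — restrict to `c = 0`.
This is where the exceptional (non-divisorial) Hodge classes of a pair of CM threefolds live (b23: a shared imaginary quadratic field FORCES them); they are algebraic
modulo Markman's theorem on Weil classes of abelian fourfolds.

[cite: Markman2025SurveySecant, Thm. 1.2] [cite: MoonenZarhin1999LowDim, Thm. 0.1, §5 (5.2)] [cite: Gordon1999HodgeAVSurvey, §3 Theorem, 7.5–7.7, 7.6.1]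
[cite: Shimura1998, §5.2, §8.2 Prop. 26, §8.4] [cite: MumfordAV1970, §19 Thm. 1 and p. 169]

## References
* [Markman2025SurveySecant] E. Markman, arXiv:2509.23403, Thm. 1.2.  [MoonenZarhin1999LowDim] B. Moonen, Yu. Zarhin, Math. Ann. 315 (1999), Thm. 0.1, §5.
  [Gordon1999HodgeAVSurvey] B. B. Gordon, *A survey of the Hodge conjecture for abelian varieties*, §3, 7.5–7.7.  [Shimura1998] G. Shimura, *Abelian varieties
  with complex multiplication and modular functions*, §5.2, §8.2, §8.4.  [MumfordAV1970] D. Mumford, *Abelian Varieties*, §19.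
-/

noncomputable section

open CategoryTheory CategoryTheory.Limits NumberField IntermediateField

namespace Summit.HodgeConjecture.CorCM.MultiFieldWeil

open Finset
open Literature.AlgebraicGeometry Literature.AlgebraicGeometry.Motives Literature.AlgebraicGeometry.HodgeTheory
open Literature.AlgebraicGeometry.ComplexMultiplication (IsCMTypeRealisation)
open Literature.AlgebraicTopology.SingularHomology
open Literature.NumberTheory.ComplexMultiplication
open Literature.AlgebraicGeometry.Milne1999 (IsOfCMType)

open scoped Classical

/-! ## §1 An imaginary quadratic subfield is a CM field and has a CM type -/

section Quadratic

variable {F : Type} [Field F] [NumberField F]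

/-- **An imaginary quadratic field is a CM field** (a totally complex quadratic extension of the totally real field `ℚ`; Mathlib
`NumberField.IsCMField.ofCMExtension`). [folklore] -/
theorem isCMField_of_isTotallyComplex_of_finrank_two [IsTotallyComplex F] (hF2 : Module.finrank ℚ F = 2) : IsCMField F := by
  haveI : Algebra.IsQuadraticExtension ℚ F := { finrank_eq_two' := hF2 }
  exact NumberField.IsCMField.ofCMExtension ℚ F

/-- **A CM type of an imaginary quadratic field**: `{σ}` for any complex embedding `σ` (the other embedding is `σ̄ ≠ σ`). [cite: Shimura1998, §5.2] -/
theorem nonempty_cmType_of_finrank_two [IsCMField F] (hF2 : Module.finrank ℚ F = 2) : Nonempty (CMType F) := by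
  obtain ⟨σ⟩ : Nonempty (F →+* ℂ) := inferInstance
  refine ⟨⟨{σ}, fun s => ?_⟩⟩
  rcases QuarticCM.eq_or_eq_conjugate_of_quadratic hF2 σ s with rfl | rfl
  · exact ⟨fun _ h => QuarticCM.conjugate_ne s h, fun _ => rfl⟩
  · refine ⟨fun h => absurd h (QuarticCM.conjugate_ne σ), fun h => absurd ?_ h⟩
    show ComplexEmbedding.conjugate (ComplexEmbedding.conjugate σ) ∈ ({σ} : Set (F →+* ℂ))
    rw [ComplexEmbedding.involutive_conjugate F σ]
    rfl

end Quadratic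

/-! ## §2 The trichotomy -/

section AnyTwo

variable {K₀ K₁ : Type} [Field K₀] [NumberField K₀] [IsCMField K₀] [Field K₁] [NumberField K₁] [IsCMField K₁] {N : ℕ}
  {T₀ T₁ : AbelianVariety ℂ} {Φ₀ : CMType K₀} {Φ₁ : CMType K₁}
  {ι₀ : 𝓞 K₀ →+* End T₀} {θ₀ : K₀ →+* Module.End ℂ (complexBetti T₀.X 1)}
  {ι₁ : 𝓞 K₁ →+* End T₁} {θ₁ : K₁ →+* Module.End ℂ (complexBetti T₁.X 1)}

omit [IsCMField K₀] [IsCMField K₁] in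
/-- **ISOGENOUS case (unconditional): every product of copies of two isogenous CM threefolds `T₀ ∼ T₁`** is an isogeny factor of a power of `T₀`, a CM abelian variety
of dimension `3`, hence satisfies the Hodge conjecture by Moonen–Zarhin's stable nondegeneracy in dimension `≤ 3` (b16's master form).
[cite: MoonenZarhin1999LowDim, §5 (5.2)] [cite: Gordon1999HodgeAVSurvey, 7.5 and 7.6.1] [cite: MumfordAV1970, §19] -/
theorem hodgeConjectureFor_biproduct_comp_vec_of_isIsogenous_threefolds (h6₀ : Module.finrank ℚ K₀ = 6) (hT₀ : IsCMTypeRealisation Φ₀ T₀ ι₀ θ₀)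
    (hiso : AbelianVariety.IsIsogenous T₀ T₁) (κ : Fin N → Fin 2) :
    HodgeConjectureFor (⨁ fun j => (![T₀, T₁] : Fin 2 → AbelianVariety ℂ) (κ j)).dim
      (⨁ fun j => (![T₀, T₁] : Fin 2 → AbelianVariety ℂ) (κ j)).X := by
  have hcm : IsOfCMType T₀ := isOfCMType_of_isCMTypeRealisation hT₀
  have hdim : T₀.dim ≤ 3 := by rw [AndreProductForm.dim_eq_of_isCMTypeRealisation hT₀, h6₀]
  -- the product of copies is isogenous to `⨁_{Fin N} T₀`
  have hXB : AbelianVariety.IsIsogenous (⨁ fun j => (![T₀, T₁] : Fin 2 → AbelianVariety ℂ) (κ j)) (⨁ fun _ : Fin N => T₀) := by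
    refine AbelianVariety.IsIsogenous.biproduct fun j => ?_
    show AbelianVariety.IsIsogenous ((![T₀, T₁] : Fin 2 → AbelianVariety ℂ) (κ j)) T₀
    generalize κ j = c
    fin_cases c
    · exact AbelianVariety.IsIsogenous.refl T₀
    · exact hiso.symm'
  -- `⨁_{Fin N} T₀` is an isogeny factor of a power of `T₀`
  obtain ⟨M, hdom⟩ := exists_avDominatedBy_biproduct_slots_powSucc (A' := fun _ : Unit => T₀) (cls := fun _ : Fin 1 => ()) (X := T₀)
    (fun u => ⟨0, by cases u; rfl⟩) (Literature.AlgebraicGeometry.Pohlmann1968.isIsogenous_powSucc_biproduct T₀ 0) (fun _ : Fin N => ())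
  exact hodgeConjectureFor_of_avDominatedBy_powSucc_of_isOfCMType_of_dim_le_three hcm hdim (Domination.AVDominatedBy.of_isIsogenous hXB hdom)

/-- **MAIN THEOREM — ANY TWO SIMPLE CM ABELIAN THREEFOLDS, given ONLY Markman's fourfold theorem.**  `T₀ ⊨ (K₀; Φ₀)`, `T₁ ⊨ (K₁; Φ₁)` SIMPLE abelian threefolds with
CM by sextic CM fields `K₀`, `K₁` — nothing else assumed.  Then for every `κ : Fin N → Fin 2` — every product `T₀^a × T₁^b` of copies — the Hodge conjecture holds for
`⨁_j ![T₀, T₁] (κ j)`, GIVEN ONLY `Markman2025_weilClasses_algebraic_abelianFourfold` (used only when `T₀ ≁ T₁` and `K₀`, `K₁` share an imaginary quadratic field — the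
case with exceptional Hodge classes; the other two cases are unconditional).  `HC_CM` is NOT asserted. [cite: Markman2025SurveySecant, Thm. 1.2]
[cite: MoonenZarhin1999LowDim, Thm. 0.1, §5 (5.2)] [cite: Gordon1999HodgeAVSurvey, §3 Theorem, 7.5–7.7] [cite: Shimura1998, §5.2, §8.2 Prop. 26, §8.4] -/
theorem hodgeConjectureFor_biproduct_comp_vec_of_any_two_simpleThreefolds_of_markman (hW4 : Markman2025_weilClasses_algebraic_abelianFourfold)
    (h6₀ : Module.finrank ℚ K₀ = 6) (h6₁ : Module.finrank ℚ K₁ = 6) (hT₀ : IsCMTypeRealisation Φ₀ T₀ ι₀ θ₀) (hT₁ : IsCMTypeRealisation Φ₁ T₁ ι₁ θ₁)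
    (hS₀ : T₀.IsSimple) (hS₁ : T₁.IsSimple) (κ : Fin N → Fin 2) :
    HodgeConjectureFor (⨁ fun j => (![T₀, T₁] : Fin 2 → AbelianVariety ℂ) (κ j)).dim
      (⨁ fun j => (![T₀, T₁] : Fin 2 → AbelianVariety ℂ) (κ j)).X := by
  by_cases hiso : AbelianVariety.IsIsogenous T₀ T₁
  · exact hodgeConjectureFor_biproduct_comp_vec_of_isIsogenous_threefolds h6₀ hT₀ hiso κ
  by_cases hsh : ∃ F : IntermediateField ℚ K₀, Module.finrank ℚ F = 2 ∧ IsTotallyComplex F ∧ Nonempty (F →+* K₁)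
  · -- a common imaginary quadratic subfield `k = F`: its CM curve `E` and gen 31's two-threefolds theorem, restricted to `c = 0`
    obtain ⟨F, hF2, hFtc, ⟨f⟩⟩ := hsh
    haveI : IsTotallyComplex F := hFtc
    haveI : IsCMField F := isCMField_of_isTotallyComplex_of_finrank_two hF2
    obtain ⟨Ψ⟩ := nonempty_cmType_of_finrank_two (F := F) hF2
    obtain ⟨E, ιE, θE, hE⟩ : ∃ (E : AbelianVariety ℂ) (ιE : 𝓞 F →+* End E) (θE : F →+* Module.End ℂ (complexBetti E.X 1)),
        IsCMTypeRealisation Ψ E ιE θE :=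
      ⟨_, _, _, Domination.isCMTypeRealisation_cmCode F cmAbelianVarietyRealised_holds Ψ⟩
    have h := hodgeConjectureFor_biproduct_comp_vec_of_two_simpleThreefolds_of_markman hW4 hF2 h6₀ h6₁ (algebraMap F K₀ : F →+* K₀) f hE hT₀ hT₁ hS₀ hS₁
      (fun j => Fin.succ (κ j))
    have hfun : (fun j => (![E, T₀, T₁] : Fin 3 → AbelianVariety ℂ) (Fin.succ (κ j))) = fun j => (![T₀, T₁] : Fin 2 → AbelianVariety ℂ) (κ j) :=
      funext fun j => Matrix.cons_val_succ E ![T₀, T₁] (κ j)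
    rw [hfun] at h
    exact h
  · -- no common imaginary quadratic subfield: unconditional (b16)
    let K : Fin 2 → Type := Fin.cons K₀ (Fin.cons K₁ finZeroElim)
    letI instF : ∀ j, Field (K j) := Fin.cons ‹Field K₀› (Fin.cons ‹Field K₁› finZeroElim)
    letI instN : ∀ j, NumberField (K j) := Fin.cons ‹NumberField K₀› (Fin.cons ‹NumberField K₁› finZeroElim)
    haveI instC : ∀ j, IsCMField (K j) := Fin.cons ‹IsCMField K₀› (Fin.cons ‹IsCMField K₁› finZeroElim)
    let Φ : ∀ j : Fin 2, CMType (K j) := Fin.cons Φ₀ (Fin.cons Φ₁ finZeroElim)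
    let ι : ∀ j : Fin 2, 𝓞 (K j) →+* End ((![T₀, T₁] : Fin 2 → AbelianVariety ℂ) j) := Fin.cons ι₀ (Fin.cons ι₁ finZeroElim)
    let θ : ∀ j : Fin 2, K j →+* Module.End ℂ (complexBetti ((![T₀, T₁] : Fin 2 → AbelianVariety ℂ) j).X 1) := Fin.cons θ₀ (Fin.cons θ₁ finZeroElim)
    have hA : ∀ j, IsCMTypeRealisation (Φ j) ((![T₀, T₁] : Fin 2 → AbelianVariety ℂ) j) (ι j) (θ j) := Fin.cons hT₀ (Fin.cons hT₁ finZeroElim)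
    have h6 : ∀ j, Module.finrank ℚ (K j) = 6 := Fin.forall_fin_two.2 ⟨h6₀, h6₁⟩
    have hS : ∀ j, ((![T₀, T₁] : Fin 2 → AbelianVariety ℂ) j).IsSimple := Fin.forall_fin_two.2 ⟨hS₀, hS₁⟩
    have hniso : ∀ i j : Fin 2, i ≠ j → ¬ AbelianVariety.IsIsogenous ((![T₀, T₁] : Fin 2 → AbelianVariety ℂ) i) ((![T₀, T₁] : Fin 2 → AbelianVariety ℂ) j) := by
      intro i j hij
      fin_cases i <;> fin_cases j
      · exact absurd rfl hij
      · exact hiso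
      · exact fun h => hiso h.symm'
      · exact absurd rfl hij
    have hno : ¬ ∃ F' : IntermediateField ℚ (K 0), Module.finrank ℚ F' = 2 ∧ IsTotallyComplex F' ∧ Nonempty (F' →+* K 1) := hsh
    exact (hodgeConjectureFor_prod_simpleThreefolds (K := K) (A := (![T₀, T₁] : Fin 2 → AbelianVariety ℂ)) (Φ := Φ) (ι := ι) (θ := θ)
      (i₀ := (0 : Fin 2)) (i₁ := (1 : Fin 2)) Fin.zero_ne_one (fun j => by fin_cases j <;> simp) h6 hA hS hniso hno κ).1

/-- **Dominated form: every abelian variety dominated by a product of copies of ANY two simple CM abelian threefolds** — everything isogenous to some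
`T₀^a × T₁^b`, every abelian subvariety or quotient of such — satisfies the Hodge conjecture, given only Markman's fourfold theorem.
[cite: Markman2025SurveySecant, Thm. 1.2] [cite: MumfordAV1970, §19 Thm. 1 and p. 169] -/
theorem hodgeConjectureFor_of_avDominatedBy_comp_vec_of_any_two_simpleThreefolds_of_markman (hW4 : Markman2025_weilClasses_algebraic_abelianFourfold)
    (h6₀ : Module.finrank ℚ K₀ = 6) (h6₁ : Module.finrank ℚ K₁ = 6) (hT₀ : IsCMTypeRealisation Φ₀ T₀ ι₀ θ₀) (hT₁ : IsCMTypeRealisation Φ₁ T₁ ι₁ θ₁)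
    (hS₀ : T₀.IsSimple) (hS₁ : T₁.IsSimple) (κ : Fin N → Fin 2) {X : AbelianVariety ℂ}
    (hX : Domination.AVDominatedBy X (⨁ fun j => (![T₀, T₁] : Fin 2 → AbelianVariety ℂ) (κ j))) :
    HodgeConjectureFor X.dim X.X :=
  Domination.hodgeConjectureFor_of_avDominatedBy
    (hodgeConjectureFor_biproduct_comp_vec_of_any_two_simpleThreefolds_of_markman hW4 h6₀ h6₁ hT₀ hT₁ hS₀ hS₁ κ) hX

/-- **In particular `T₀ × T₁` itself**, for ANY two simple CM abelian threefolds, given only Markman's fourfold theorem. [cite: Markman2025SurveySecant, Thm. 1.2]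
[cite: MoonenZarhin1999LowDim, Thm. 0.1] -/
theorem hodgeConjectureFor_prod_of_any_two_simpleThreefolds_of_markman (hW4 : Markman2025_weilClasses_algebraic_abelianFourfold)
    (h6₀ : Module.finrank ℚ K₀ = 6) (h6₁ : Module.finrank ℚ K₁ = 6) (hT₀ : IsCMTypeRealisation Φ₀ T₀ ι₀ θ₀) (hT₁ : IsCMTypeRealisation Φ₁ T₁ ι₁ θ₁)
    (hS₀ : T₀.IsSimple) (hS₁ : T₁.IsSimple) :
    HodgeConjectureFor (T₀.prod T₁).dim (T₀.prod T₁).X :=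
  PairWeights.hodgeConjectureFor_prod_of_biproduct (A := (![T₀, T₁] : Fin 2 → AbelianVariety ℂ))
    (hodgeConjectureFor_biproduct_comp_vec_of_any_two_simpleThreefolds_of_markman hW4 h6₀ h6₁ hT₀ hT₁ hS₀ hS₁ (id : Fin 2 → Fin 2))

/-! ## §3 Every abelian variety isogenous to a product of copies of two simple CM threefolds, and all its powers -/

/-- **The Hodge conjecture for every abelian variety ISOGENOUS TO A PRODUCT OF COPIES of two simple CM abelian threefolds** (indexed by any finite type `J`), given
only Markman's fourfold theorem: re-index by `Fin |J|` and dominate. [cite: Markman2025SurveySecant, Thm. 1.2] [cite: MumfordAV1970, §19] -/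
theorem hodgeConjectureFor_of_isIsogenous_biproduct_comp_of_any_two_simpleThreefolds_of_markman (hW4 : Markman2025_weilClasses_algebraic_abelianFourfold)
    (h6₀ : Module.finrank ℚ K₀ = 6) (h6₁ : Module.finrank ℚ K₁ = 6) (hT₀ : IsCMTypeRealisation Φ₀ T₀ ι₀ θ₀) (hT₁ : IsCMTypeRealisation Φ₁ T₁ ι₁ θ₁)
    (hS₀ : T₀.IsSimple) (hS₁ : T₁.IsSimple) {J : Type} [Fintype J] (cls : J → Fin 2) {X : AbelianVariety ℂ}
    (hX : AbelianVariety.IsIsogenous X (⨁ fun j => (![T₀, T₁] : Fin 2 → AbelianVariety ℂ) (cls j))) :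
    HodgeConjectureFor X.dim X.X := by
  classical
  let ε : Fin (Fintype.card J) ≃ J := (Fintype.equivFin J).symm
  have e : (⨁ fun j => (![T₀, T₁] : Fin 2 → AbelianVariety ℂ) (cls j)) ≅ ⨁ fun l => (![T₀, T₁] : Fin 2 → AbelianVariety ℂ) (cls (ε l)) :=
    (biproduct.reindex ε fun j => (![T₀, T₁] : Fin 2 → AbelianVariety ℂ) (cls j)).symm
  exact hodgeConjectureFor_of_avDominatedBy_comp_vec_of_any_two_simpleThreefolds_of_markman hW4 h6₀ h6₁ hT₀ hT₁ hS₀ hS₁ (fun l => cls (ε l))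
    (Domination.AVDominatedBy.of_isIsogenous hX ((Domination.AVDominatedBy.refl _).of_iso_right e))

/-- **… and for ALL POWERS of such an abelian variety** (`X ∼ ⨁_{j : J} ![T₀, T₁] (cls j)` ⟹ `HodgeConjectureFor (X^{N+1})` for every `N`: each power is an isogeny factor
of a product of copies, `exists_avDominatedBy_powSucc_biproduct_slots_of_isIsogenous`), given only Markman's fourfold theorem — `X` is «stably Hodge» granted Markman,
although `B•(Xⁿ) ≠ D•(Xⁿ)` when the fields share an imaginary quadratic field. [cite: Markman2025SurveySecant, Thm. 1.2] [cite: Gordon1999HodgeAVSurvey, 7.6.1]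
[cite: MumfordAV1970, §19] -/
theorem hodgeConjectureFor_powSucc_of_isIsogenous_biproduct_comp_of_any_two_simpleThreefolds_of_markman
    (hW4 : Markman2025_weilClasses_algebraic_abelianFourfold)
    (h6₀ : Module.finrank ℚ K₀ = 6) (h6₁ : Module.finrank ℚ K₁ = 6) (hT₀ : IsCMTypeRealisation Φ₀ T₀ ι₀ θ₀) (hT₁ : IsCMTypeRealisation Φ₁ T₁ ι₁ θ₁)
    (hS₀ : T₀.IsSimple) (hS₁ : T₁.IsSimple) {J : Type} [Fintype J] (cls : J → Fin 2) {X : AbelianVariety ℂ}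
    (hX : AbelianVariety.IsIsogenous X (⨁ fun j => (![T₀, T₁] : Fin 2 → AbelianVariety ℂ) (cls j))) (N : ℕ) :
    HodgeConjectureFor (X.powSucc N).dim (X.powSucc N).X := by
  obtain ⟨n, ρ, hdom⟩ := exists_avDominatedBy_powSucc_biproduct_slots_of_isIsogenous hX N
  exact hodgeConjectureFor_of_avDominatedBy_comp_vec_of_any_two_simpleThreefolds_of_markman hW4 h6₀ h6₁ hT₀ hT₁ hS₀ hS₁ ρ hdom

end AnyTwo

end Summit.HodgeConjecture.CorCM.MultiFieldWeil

end
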